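import Literature.Geometry.ComplexHyperbolic.UnitBallLieAlgebraHCClosure      -- ★ (d2) FILE 1 p846595: closure, linearity, `contDiffOn_liePhi`, sup-norm basis bound
import Literature.Geometry.ComplexHyperbolic.UnitBallLieAlgebraHCCubic        -- (b3) F0P2-p01 (g14): `liePhi_lieCubic` (E3)
import Literature.Analysis.Calculus.PolynomialDerivOperator                    -- p09 (g2): `polyDeriv` — linear, multiplicative on smooth functions, the `iteratedFDeriv` bridge
import Literature.Algebra.Polynomial.S3HarmonicModule                          -- ★ (e) p09 (g2): `s3PowerSum`, `s3HarmonicPoly`, `exists_adjoin_powerSum_combination`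
import HarnessLib

/-!
# Harish-Chandra's dictionary `∂(q)φ_f = φ_{Z_q f}` for every `S₃`-invariant `q`, and the reduction of ALL jets of `φ_f` to jets of orders `≤ 3`
# (ROAD «A6-IV» brick (d2) FILE 2 «HC DICTIONARY»; Warner II, proof of Thm. 8.4.3.1, the algebraic half)

Topic `Geometry/ComplexHyperbolic`; namespace `Literature.Geometry.ComplexHyperbolic.BallModel`.  THEOREMS ONLY (no `def`, no instance, no notation, no axiom, no named fact, no `sorry`).
Cell `pub/hodgecm-mathlib`, ENGINE T1 (crux H413 = `stmt-HodgeConjecture-24833`); ROAD A, design of record `DESIGN-A6-InHouse-v2-ArchitectureIV` 93542b84 (LEAD T11-4), owner word R-15.9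
((d2) plan, FILE 2 of 3); author F0P3a-p05 (g15) (ROAD A owner), 2026-09-01.

THE MATHEMATICS [WarnerHASSLG2, proof of Thm. 8.4.3.1; HarishChandra1957DiffOps, Thm. 1].  `φ_h = liePhi μ h = π·Φ_h` on the Cartan subalgebra `𝔧 ≅ ℝ³` of `𝔲(2,1)`, `U₀ = {π ≠ 0}` the regular set.
* §1 `∂(p_r)φ = Σ_i D^rφ(e_i,…,e_i)` for the power sums `p_r = Σ_i X_i^r` (p09's bridge `∂(∏X_{k_j})φ = Dⁿφ(e_{k_1},…,e_{k_n})`).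
* §2 THE GENERATORS in `∂`-form on `U₀`: `∂(p₁)φ_h = φ_{lieCentral h}` (★ (E1)), `∂(p₂)φ_h = φ_{−lieLaplacian h}` (★ (E2)), `∂(p₃)φ_h = φ_{(1∕6)·lieCubic h}` (★ (E3)).
* §3 THE DICTIONARY: for every `c` in the subalgebra generated by `p₁, p₂, p₃` there is an operator `Z_c` on `C_c^∞(𝔤)`, smooth-to-smooth and NOT ENLARGING SUPPORTS, with `∂(c)φ_h = φ_{Z_c h}` on `U₀`
  (`Algebra.adjoin_induction`: sums by linearity of `h ↦ φ_h(θ)` ★ FILE 1, products by p09's `polyDeriv_mul_eqOn` + locality on the open `U₀` + closure ★ FILE 1) — stated EXISTENTIALLY, so no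
  word∕operator definitions are needed.
* §4 PURE PARTIALS THROUGH THE HARMONICS: by ★ (e) `∏_j X_{k_j} = Σ_{j<6} c_j·u_j` with `c_j ∈ ℝ[p₁,p₂,p₃]`, `u = (1, X₀−X₁, X₁−X₂, ∂₀π, ∂₁π, π)`, hence on `U₀`
  **`Dⁿφ_f(θ)(e_{k_1},…,e_{k_n}) = Σ_j ∂(u_j) φ_{Z_{k,j} f}(θ)`** with `Z_{k,j} f ∈ C_c^∞`, `tsupport ⊆ tsupport f`.
* §5 `‖∂(u_j)ψ(y)‖ ≤ 6·Σ_{i<4} ‖Dⁱψ(y)‖` (the six harmonics have degree `≤ 3` and integer coefficients of absolute sum `≤ 6`).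
* §6 **THE REDUCTION**: if every `h ∈ C^∞` with `tsupport h ⊆ tsupport f` obeys a bound `‖Dⁱφ_h(θ)‖ ≤ C(h,i)·w(θ)` on a set `S ⊆ U₀` for the orders `i < 4`, then `‖Dⁿφ_f(θ)‖ ≤ C_n·w(θ)` on `S`
  for EVERY `n` — with the SAME weight `w`: the crude polynomial loss of (c3′) at orders `≤ 3` is the loss at all orders, which is the hypothesis of the line-integration bootstrap ★ (d1″)∕(d1‴).
HONEST LABEL: HC_CM is proved only modulo the printed citations until rung 0 closes; pays nothing by itself.

## References
* [WarnerHASSLG2] G. Warner, *Harmonic Analysis on Semi-Simple Lie Groups II*, Grundlehren 189 (1972), §8.4.3, proof of Thm. 8.4.3.1 (the `I(𝔧)`-finite system and the uniform exponent).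
* [HarishChandra1957DiffOps] Harish-Chandra, *Differential operators on a semisimple Lie algebra*, Amer. J. Math. 79 (1957), Thm. 1 (`φ_{∂(P)f} = ∂(γ(P))φ_f`).
* [Humphreys1990] J. E. Humphreys, *Reflection Groups and Coxeter Groups* (1990), §3.6 (`S(𝔧)` over `S(𝔧)^W`, harmonic polynomials).
-/

set_option autoImplicit false

noncomputable section

namespace Literature.Geometry.ComplexHyperbolic

namespace BallModel

open _root_.Complex _root_.Matrix _root_.MeasureTheory _root_.Set _root_.Filter _root_.Topology _root_.Function _root_.MvPolynomial
open Literature.Analysis.Calculus Literature.Algebra.Polynomial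
open scoped Matrix.Norms.Operator ComplexConjugate ContDiff

variable {E : Type*} [NormedAddCommGroup E] [NormedSpace ℝ E]

/-! ## §1 Power sums under `∂`: `∂(Σ_i X_i^r)φ(y) = Σ_i D^rφ(y)(e_i,…,e_i)` -/

section PowerSums

variable {U : Set (Fin 3 → ℝ)} {φ : (Fin 3 → ℝ) → E} {y : Fin 3 → ℝ}

/-- `∂(X_i^r)φ(y) = D^rφ(y)(e_i,…,e_i)` for `φ` smooth on the open `U ∋ y`. [cite: HarishChandra1957DiffOps, Thm. 1] -/
theorem polyDeriv_X_pow_apply (hU : IsOpen U) (hφ : ContDiffOn ℝ ∞ φ U) (i : Fin 3) (r : ℕ) (hy : y ∈ U) :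
    polyDeriv (X i ^ r : MvPolynomial (Fin 3) ℝ) φ y = iteratedFDeriv ℝ r φ y (fun _ => Pi.single i (1 : ℝ)) := by
  have h : (X i ^ r : MvPolynomial (Fin 3) ℝ) = ∏ _j : Fin r, X i := by rw [Finset.prod_const, Finset.card_univ, Fintype.card_fin]
  rw [h, polyDeriv_prod_X_apply_eq_iteratedFDeriv hU hφ (fun _ : Fin r => i) hy]

/-- `∂(s3PowerSum r)φ(y) = Σ_i D^rφ(y)(e_i,…,e_i)`. [cite: HarishChandra1957DiffOps, Thm. 1] -/
theorem polyDeriv_s3PowerSum_apply (hU : IsOpen U) (hφ : ContDiffOn ℝ ∞ φ U) (r : ℕ) (hy : y ∈ U) :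
    polyDeriv (s3PowerSum r) φ y = ∑ i : Fin 3, iteratedFDeriv ℝ r φ y (fun _ => Pi.single i (1 : ℝ)) := by
  rw [s3PowerSum, polyDeriv_add, polyDeriv_add, Pi.add_apply, Pi.add_apply, polyDeriv_X_pow_apply hU hφ 0 r hy, polyDeriv_X_pow_apply hU hφ 1 r hy,
    polyDeriv_X_pow_apply hU hφ 2 r hy, Fin.sum_univ_three]

/-- `∂(q − q') = ∂(q) − ∂(q')` (exact). [cite: HarishChandra1957DiffOps, Thm. 1] -/
theorem polyDeriv_sub' {m : ℕ} (q q' : MvPolynomial (Fin m) ℝ) (φ : (Fin m → ℝ) → E) : polyDeriv (q - q') φ = polyDeriv q φ - polyDeriv q' φ := by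
  show polyDerivLin (q - q') φ = polyDerivLin q φ - polyDerivLin q' φ
  rw [map_sub]; rfl

/-- `∂(−q) = −∂(q)` (exact). [cite: HarishChandra1957DiffOps, Thm. 1] -/
theorem polyDeriv_neg' {m : ℕ} (q : MvPolynomial (Fin m) ℝ) (φ : (Fin m → ℝ) → E) : polyDeriv (-q) φ = -polyDeriv q φ := by
  show polyDerivLin (-q) φ = -polyDerivLin q φ
  rw [map_neg]; rfl

end PowerSums

/-! ## §2 The three generators in `∂`-form on the regular set -/

section Generators

variable [CompleteSpace E]

/-- **(E1) in `∂`-form**: `∂(p₁)φ_h(θ) = φ_{lieCentral h}(θ)` on `U₀`. [cite: HarishChandra1957DiffOps, Thm. 1] [cite: WarnerHASSLG2, §8.4.3] -/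
theorem polyDeriv_powerSum_one_liePhi (μ : Measure U21) [IsFiniteMeasureOnCompacts μ] {h : Matrix (Fin 3) (Fin 3) ℂ → E} (hh : ContDiff ℝ ∞ h) (hhc : HasCompactSupport h)
    {θ : Fin 3 → ℝ} (hθ : rootProduct θ ≠ 0) : polyDeriv (s3PowerSum 1) (liePhi μ h) θ = liePhi μ (lieCentral h) θ := by
  have h02 : θ 0 ≠ θ 2 := sub_ne_zero.1 (sub_ne_zero_of_rootProduct_ne_zero hθ).2.1
  have h12 : θ 1 ≠ θ 2 := sub_ne_zero.1 (sub_ne_zero_of_rootProduct_ne_zero hθ).2.2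
  rw [polyDeriv_s3PowerSum_apply isOpen_setOf_rootProduct_ne_zero (contDiffOn_liePhi μ hh hhc) 1 hθ, liePhi_lieCentral μ hh hhc θ h02 h12]
  simp only [iteratedFDeriv_one_apply]
  rw [← map_sum]
  congr 1
  funext l
  simp [Finset.sum_apply, Pi.single_apply]

/-- **(E2) in `∂`-form**: `∂(p₂)φ_h(θ) = φ_{−lieLaplacian h}(θ)` on `U₀` (`∂(p₂) = Δ_θ`, `φ_{∂(ω)h} = −Δ_θφ_h`). [cite: HarishChandra1957DiffOps, Thm. 1] [cite: WarnerHASSLG2, §8.4.3] -/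
theorem polyDeriv_powerSum_two_liePhi (μ : Measure U21) [IsFiniteMeasureOnCompacts μ] [μ.IsMulRightInvariant] {h : Matrix (Fin 3) (Fin 3) ℂ → E} (hh : ContDiff ℝ ∞ h)
    (hhc : HasCompactSupport h) {θ : Fin 3 → ℝ} (hθ : rootProduct θ ≠ 0) : polyDeriv (s3PowerSum 2) (liePhi μ h) θ = liePhi μ (-(lieLaplacian h)) θ := by
  rw [polyDeriv_s3PowerSum_apply isOpen_setOf_rootProduct_ne_zero (contDiffOn_liePhi μ hh hhc) 2 hθ, liePhi_neg, liePhi_lieLaplacian μ hh hhc θ hθ, neg_neg]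
  refine Finset.sum_congr rfl fun i _ => ?_
  congr 1
  funext j
  fin_cases j <;> rfl

/-- **(E3) in `∂`-form**: `∂(p₃)φ_h(θ) = φ_{(1∕6)·lieCubic h}(θ)` on `U₀` ((b3) `φ_{∂(D³P₃)h} = 6·Σ_k ∂_k³φ_h`). [cite: HarishChandra1957DiffOps, Thm. 1] [cite: WarnerHASSLG2, §8.4.3] -/
theorem polyDeriv_powerSum_three_liePhi (μ : Measure U21) [IsFiniteMeasureOnCompacts μ] [μ.IsMulRightInvariant] {h : Matrix (Fin 3) (Fin 3) ℂ → E} (hh : ContDiff ℝ ∞ h)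
    (hhc : HasCompactSupport h) {θ : Fin 3 → ℝ} (hθ : rootProduct θ ≠ 0) :
    polyDeriv (s3PowerSum 3) (liePhi μ h) θ = liePhi μ ((6 : ℝ)⁻¹ • lieCubic h) θ := by
  rw [polyDeriv_s3PowerSum_apply isOpen_setOf_rootProduct_ne_zero (contDiffOn_liePhi μ hh hhc) 3 hθ, liePhi_const_smul, liePhi_lieCubic μ hh hhc θ hθ, smul_smul,
    inv_mul_cancel₀ (by norm_num : (6 : ℝ) ≠ 0), one_smul]
  refine Finset.sum_congr rfl fun i _ => ?_
  congr 1
  funext j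
  fin_cases j <;> rfl

end Generators

/-! ## §3 The dictionary `∂(c)φ_h = φ_{Z_c h}` for `c ∈ ℝ[p₁,p₂,p₃]` (existential, by `adjoin` induction) -/

section Dictionary

omit [NormedSpace ℝ E] in
/-- `tsupport (h₁ + h₂) ⊆ tsupport h₁ ∪ tsupport h₂`. [cite: HarishChandra1957DiffOps, Thm. 1] -/
theorem tsupport_add_subset (h₁ h₂ : Matrix (Fin 3) (Fin 3) ℂ → E) : tsupport (h₁ + h₂) ⊆ tsupport h₁ ∪ tsupport h₂ := by
  rw [tsupport, tsupport, tsupport, ← closure_union]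
  exact closure_mono (Function.support_add h₁ h₂)

omit [NormedSpace ℝ E] in
/-- `tsupport (-h) = tsupport h`. [cite: HarishChandra1957DiffOps, Thm. 1] -/
theorem tsupport_neg_eq (h : Matrix (Fin 3) (Fin 3) ℂ → E) : tsupport (-h) = tsupport h := by
  rw [tsupport, tsupport]
  congr 1
  ext X
  simp only [Function.mem_support, Pi.neg_apply, ne_eq, neg_eq_zero]

variable [CompleteSpace E]

/-- **HARISH-CHANDRA's DICTIONARY** (existential form): for every `c` in the subalgebra of `ℝ[X₀,X₁,X₂]` generated by the power sums `p₁, p₂, p₃` there is an operator `Z` on functions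
`M₃(ℂ) → E`, mapping `C^∞` to `C^∞` and with `tsupport (Z h) ⊆ tsupport h`, such that `∂(c)(liePhi μ h) = liePhi μ (Z h)` on the regular set for every `h ∈ C_c^∞`
(`μ` finite on compacta and right-invariant). [cite: HarishChandra1957DiffOps, Thm. 1] [cite: WarnerHASSLG2, §8.4.3, proof of Thm. 8.4.3.1] -/
theorem exists_lieOp_of_mem_adjoin (μ : Measure U21) [IsFiniteMeasureOnCompacts μ] [μ.IsMulRightInvariant] {c : MvPolynomial (Fin 3) ℝ}
    (hc : c ∈ Algebra.adjoin ℝ (Set.range s3PowerSumVec)) :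
    ∃ Z : (Matrix (Fin 3) (Fin 3) ℂ → E) → (Matrix (Fin 3) (Fin 3) ℂ → E),
      (∀ h, ContDiff ℝ ∞ h → ContDiff ℝ ∞ (Z h)) ∧ (∀ h, tsupport (Z h) ⊆ tsupport h) ∧
      ∀ h, ContDiff ℝ ∞ h → HasCompactSupport h → EqOn (polyDeriv c (liePhi μ h)) (liePhi μ (Z h)) {θ : Fin 3 → ℝ | rootProduct θ ≠ 0} := by
  induction hc using Algebra.adjoin_induction with
  | mem x hx =>
      obtain ⟨i, rfl⟩ := hx
      fin_cases i
      · refine ⟨fun h => lieCentral h, fun h hh => contDiff_lieCentral hh, fun h => tsupport_lieCentral_subset h, fun h hh hhc θ hθ => ?_⟩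
        exact polyDeriv_powerSum_one_liePhi μ hh hhc hθ
      · refine ⟨fun h => -(lieLaplacian h), fun h hh => (contDiff_lieLaplacian hh).neg, fun h => ?_, fun h hh hhc θ hθ => ?_⟩
        · rw [tsupport_neg_eq]; exact tsupport_lieLaplacian_subset h
        · exact polyDeriv_powerSum_two_liePhi μ hh hhc hθ
      · refine ⟨fun h => (6 : ℝ)⁻¹ • lieCubic h, fun h hh => (contDiff_lieCubic hh).const_smul _, fun h => ?_, fun h hh hhc θ hθ => ?_⟩
        · exact (tsupport_const_smul_subset _ _).trans (tsupport_lieCubic_subset h)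
        · exact polyDeriv_powerSum_three_liePhi μ hh hhc hθ
  | algebraMap r =>
      refine ⟨fun h => r • h, fun h hh => hh.const_smul r, fun h => tsupport_const_smul_subset r h, fun h _ _ θ _ => ?_⟩
      rw [MvPolynomial.algebraMap_eq, polyDeriv_C, liePhi_const_smul_fun]
  | add x y _ _ ihx ihy =>
      obtain ⟨Zx, hZx1, hZx2, hZx3⟩ := ihx
      obtain ⟨Zy, hZy1, hZy2, hZy3⟩ := ihy
      refine ⟨fun h => Zx h + Zy h, fun h hh => (hZx1 h hh).add (hZy1 h hh), fun h => ?_, fun h hh hhc θ hθ => ?_⟩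
      · exact (tsupport_add_subset _ _).trans (union_subset (hZx2 h) (hZy2 h))
      · have h02 : θ 0 ≠ θ 2 := sub_ne_zero.1 (sub_ne_zero_of_rootProduct_ne_zero hθ).2.1
        have h12 : θ 1 ≠ θ 2 := sub_ne_zero.1 (sub_ne_zero_of_rootProduct_ne_zero hθ).2.2
        rw [polyDeriv_add, Pi.add_apply, hZx3 h hh hhc hθ, hZy3 h hh hhc hθ,
          liePhi_add μ (hZx1 h hh).continuous (HasCompactSupport.of_support_subset_isCompact hhc ((subset_tsupport _).trans (hZx2 h)))
            (hZy1 h hh).continuous (HasCompactSupport.of_support_subset_isCompact hhc ((subset_tsupport _).trans (hZy2 h))) θ h02 h12]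
  | mul x y _ _ ihx ihy =>
      obtain ⟨Zx, hZx1, hZx2, hZx3⟩ := ihx
      obtain ⟨Zy, hZy1, hZy2, hZy3⟩ := ihy
      refine ⟨fun h => Zx (Zy h), fun h hh => hZx1 _ (hZy1 h hh), fun h => (hZx2 _).trans (hZy2 h), fun h hh hhc θ hθ => ?_⟩
      have hyc : HasCompactSupport (Zy h) := HasCompactSupport.of_support_subset_isCompact hhc ((subset_tsupport _).trans (hZy2 h))
      rw [polyDeriv_mul_eqOn isOpen_setOf_rootProduct_ne_zero x y (contDiffOn_liePhi μ hh hhc) hθ,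
        polyDeriv_congr_eqOn isOpen_setOf_rootProduct_ne_zero x (hZy3 h hh hhc) hθ, hZx3 (Zy h) (hZy1 h hh) hyc hθ]

end Dictionary

/-! ## §4 Pure partials of `φ_f` through the harmonic basis -/

section Harmonics

variable [CompleteSpace E]

/-- **PURE PARTIALS THROUGH THE HARMONICS**: for every coordinate tuple `k : Fin n → Fin 3` there are six operators `Z_j` (smooth-to-smooth, `tsupport (Z_j h) ⊆ tsupport h`) with
`Dⁿ(liePhi μ f)(θ)(e_{k_1},…,e_{k_n}) = Σ_{j<6} ∂(u_j)(liePhi μ (Z_j f))(θ)` at every regular `θ`, for every `f ∈ C_c^∞` — Harish-Chandra's «`∂(S(𝔧)) ⊆ Σ_j ∂(u_j)·∂(I(𝔧))`».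
[cite: WarnerHASSLG2, §8.4.3, proof of Thm. 8.4.3.1] [cite: Humphreys1990, §3.6] -/
theorem exists_lieOps_iteratedFDeriv_liePhi_apply_single (μ : Measure U21) [IsFiniteMeasureOnCompacts μ] [μ.IsMulRightInvariant] {n : ℕ} (k : Fin n → Fin 3) :
    ∃ Z : Fin 6 → (Matrix (Fin 3) (Fin 3) ℂ → E) → (Matrix (Fin 3) (Fin 3) ℂ → E),
      (∀ j h, ContDiff ℝ ∞ h → ContDiff ℝ ∞ (Z j h)) ∧ (∀ j h, tsupport (Z j h) ⊆ tsupport h) ∧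
      ∀ f : Matrix (Fin 3) (Fin 3) ℂ → E, ContDiff ℝ ∞ f → HasCompactSupport f → ∀ θ : Fin 3 → ℝ, rootProduct θ ≠ 0 →
        iteratedFDeriv ℝ n (liePhi μ f) θ (fun j => Pi.single (k j) (1 : ℝ)) = ∑ j : Fin 6, polyDeriv (s3HarmonicPoly j) (liePhi μ (Z j f)) θ := by
  obtain ⟨c, hc, hq⟩ := exists_adjoin_powerSum_combination (∏ j : Fin n, X (k j) : MvPolynomial (Fin 3) ℝ)
  choose Z hZ1 hZ2 hZ3 using fun j : Fin 6 => exists_lieOp_of_mem_adjoin (E := E) μ (hc j)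
  refine ⟨Z, hZ1, hZ2, fun f hf hfc θ hθ => ?_⟩
  have hU := isOpen_setOf_rootProduct_ne_zero
  have hφ := contDiffOn_liePhi μ hf hfc
  rw [← polyDeriv_prod_X_apply_eq_iteratedFDeriv hU hφ k hθ, hq, polyDeriv_sum, Finset.sum_apply]
  refine Finset.sum_congr rfl fun j _ => ?_
  rw [mul_comm, polyDeriv_mul_eqOn hU _ _ hφ hθ, polyDeriv_congr_eqOn hU _ (hZ3 j f hf hfc) hθ]

end Harmonics

/-! ## §5 `‖∂(u_j)ψ(y)‖ ≤ 6·Σ_{i<4} ‖Dⁱψ(y)‖` for the six harmonics -/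

section HarmonicBounds

variable {U : Set (Fin 3 → ℝ)} {ψ : (Fin 3 → ℝ) → E} {y : Fin 3 → ℝ}

/-- `‖∂(X_{k_1}⋯X_{k_r})ψ(y)‖ ≤ ‖D^rψ(y)‖` (the coordinate vectors have sup norm `1`). [cite: WarnerHASSLG2, §8.4.3] -/
theorem norm_polyDeriv_prod_X_le (hU : IsOpen U) (hψ : ContDiffOn ℝ ∞ ψ U) {r : ℕ} (k : Fin r → Fin 3) (hy : y ∈ U) :
    ‖polyDeriv (∏ j : Fin r, X (k j) : MvPolynomial (Fin 3) ℝ) ψ y‖ ≤ ‖iteratedFDeriv ℝ r ψ y‖ := by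
  rw [polyDeriv_prod_X_apply_eq_iteratedFDeriv hU hψ k hy]
  refine (ContinuousMultilinearMap.le_opNorm _ _).trans (le_of_eq ?_)
  rw [Finset.prod_eq_one fun j _ => ?_, mul_one]
  rw [Pi.norm_single, norm_one]

/-- A single order is dominated by the sum of the orders `< 4`. [cite: WarnerHASSLG2, §8.4.3] -/
theorem norm_iteratedFDeriv_le_sum_range_four (ψ : (Fin 3 → ℝ) → E) (y : Fin 3 → ℝ) {r : ℕ} (hr : r < 4) :
    ‖iteratedFDeriv ℝ r ψ y‖ ≤ ∑ i ∈ Finset.range 4, ‖iteratedFDeriv ℝ i ψ y‖ :=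
  Finset.single_le_sum (f := fun i => ‖iteratedFDeriv ℝ i ψ y‖) (fun _ _ => norm_nonneg _) (Finset.mem_range.2 hr)

/-- `u₀ = 1`: `‖∂(u₀)ψ(y)‖ = ‖ψ(y)‖ ≤ 6·Σ_{i<4}‖Dⁱψ(y)‖`. [cite: Humphreys1990, §3.6] -/
theorem norm_polyDeriv_s3HarmonicPoly_zero_le (ψ : (Fin 3 → ℝ) → E) (y : Fin 3 → ℝ) :
    ‖polyDeriv (s3HarmonicPoly 0) ψ y‖ ≤ 6 * ∑ i ∈ Finset.range 4, ‖iteratedFDeriv ℝ i ψ y‖ := by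
  have h1 : s3HarmonicPoly 0 = C (1 : ℝ) := by simp [s3HarmonicPoly]
  rw [h1, polyDeriv_C, one_smul, ← norm_iteratedFDeriv_zero (𝕜 := ℝ) (f := ψ)]
  have h := norm_iteratedFDeriv_le_sum_range_four ψ y (show 0 < 4 by norm_num)
  have h0 : 0 ≤ ∑ i ∈ Finset.range 4, ‖iteratedFDeriv ℝ i ψ y‖ := Finset.sum_nonneg fun _ _ => norm_nonneg _
  linarith

/-- Degree one: `‖∂(X_a − X_b)ψ(y)‖ ≤ 2‖Dψ(y)‖`. [cite: Humphreys1990, §3.6] -/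
theorem norm_polyDeriv_X_sub_X_le (hU : IsOpen U) (hψ : ContDiffOn ℝ ∞ ψ U) (a b : Fin 3) (hy : y ∈ U) :
    ‖polyDeriv (X a - X b : MvPolynomial (Fin 3) ℝ) ψ y‖ ≤ 2 * ‖iteratedFDeriv ℝ 1 ψ y‖ := by
  have ha : (X a : MvPolynomial (Fin 3) ℝ) = ∏ j : Fin 1, X ((fun _ => a) j) := by simp
  have hb : (X b : MvPolynomial (Fin 3) ℝ) = ∏ j : Fin 1, X ((fun _ => b) j) := by simp
  rw [polyDeriv_sub', Pi.sub_apply]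
  refine (norm_sub_le _ _).trans ?_
  have h1 := norm_polyDeriv_prod_X_le hU hψ (fun _ : Fin 1 => a) hy
  have h2 := norm_polyDeriv_prod_X_le hU hψ (fun _ : Fin 1 => b) hy
  rw [← ha] at h1; rw [← hb] at h2
  linarith

/-- A signed combination of four degree-two products with coefficients of absolute sum `6`. [cite: Humphreys1990, §3.6] -/
theorem norm_polyDeriv_quadratic_le (hU : IsOpen U) (hψ : ContDiffOn ℝ ∞ ψ U) (hy : y ∈ U) (k₁ k₂ k₃ k₄ : Fin 2 → Fin 3) (c₁ c₂ c₃ c₄ : ℝ)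
    (hc : |c₁| + |c₂| + |c₃| + |c₄| ≤ 6) :
    ‖polyDeriv (C c₁ * ∏ j, X (k₁ j) + C c₂ * ∏ j, X (k₂ j) + C c₃ * ∏ j, X (k₃ j) + C c₄ * ∏ j, X (k₄ j) : MvPolynomial (Fin 3) ℝ) ψ y‖ ≤
      6 * ‖iteratedFDeriv ℝ 2 ψ y‖ := by
  rw [polyDeriv_add, polyDeriv_add, polyDeriv_add, polyDeriv_C_mul, polyDeriv_C_mul, polyDeriv_C_mul, polyDeriv_C_mul]
  simp only [Pi.add_apply, Pi.smul_apply]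
  have h1 := norm_polyDeriv_prod_X_le hU hψ k₁ hy
  have h2 := norm_polyDeriv_prod_X_le hU hψ k₂ hy
  have h3 := norm_polyDeriv_prod_X_le hU hψ k₃ hy
  have h4 := norm_polyDeriv_prod_X_le hU hψ k₄ hy
  have hD : 0 ≤ ‖iteratedFDeriv ℝ 2 ψ y‖ := norm_nonneg _
  calc _ ≤ ‖c₁ • polyDeriv (∏ j, X (k₁ j) : MvPolynomial (Fin 3) ℝ) ψ y‖ + ‖c₂ • polyDeriv (∏ j, X (k₂ j) : MvPolynomial (Fin 3) ℝ) ψ y‖ +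
        ‖c₃ • polyDeriv (∏ j, X (k₃ j) : MvPolynomial (Fin 3) ℝ) ψ y‖ + ‖c₄ • polyDeriv (∏ j, X (k₄ j) : MvPolynomial (Fin 3) ℝ) ψ y‖ := norm_add₄_le
    _ ≤ |c₁| * ‖iteratedFDeriv ℝ 2 ψ y‖ + |c₂| * ‖iteratedFDeriv ℝ 2 ψ y‖ + |c₃| * ‖iteratedFDeriv ℝ 2 ψ y‖ + |c₄| * ‖iteratedFDeriv ℝ 2 ψ y‖ := by
        simp only [norm_smul, Real.norm_eq_abs]
        gcongr
    _ ≤ 6 * ‖iteratedFDeriv ℝ 2 ψ y‖ := by nlinarith [abs_nonneg c₁, abs_nonneg c₂, abs_nonneg c₃, abs_nonneg c₄]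

/-- A signed combination of six degree-three products with coefficients `±1`. [cite: Humphreys1990, §3.6] -/
theorem norm_polyDeriv_cubic_le (hU : IsOpen U) (hψ : ContDiffOn ℝ ∞ ψ U) (hy : y ∈ U) (k₁ k₂ k₃ k₄ k₅ k₆ : Fin 3 → Fin 3) :
    ‖polyDeriv (∏ j, X (k₁ j) - ∏ j, X (k₂ j) + ∏ j, X (k₃ j) - ∏ j, X (k₄ j) + ∏ j, X (k₅ j) - ∏ j, X (k₆ j) : MvPolynomial (Fin 3) ℝ) ψ y‖ ≤
      6 * ‖iteratedFDeriv ℝ 3 ψ y‖ := by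
  rw [polyDeriv_sub', polyDeriv_add, polyDeriv_sub', polyDeriv_add, polyDeriv_sub']
  simp only [Pi.add_apply, Pi.sub_apply]
  have h1 := norm_polyDeriv_prod_X_le hU hψ k₁ hy
  have h2 := norm_polyDeriv_prod_X_le hU hψ k₂ hy
  have h3 := norm_polyDeriv_prod_X_le hU hψ k₃ hy
  have h4 := norm_polyDeriv_prod_X_le hU hψ k₄ hy
  have h5 := norm_polyDeriv_prod_X_le hU hψ k₅ hy
  have h6 := norm_polyDeriv_prod_X_le hU hψ k₆ hy
  set A := polyDeriv (∏ j, X (k₁ j) : MvPolynomial (Fin 3) ℝ) ψ y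
  set B := polyDeriv (∏ j, X (k₂ j) : MvPolynomial (Fin 3) ℝ) ψ y
  set C' := polyDeriv (∏ j, X (k₃ j) : MvPolynomial (Fin 3) ℝ) ψ y
  set D := polyDeriv (∏ j, X (k₄ j) : MvPolynomial (Fin 3) ℝ) ψ y
  set E' := polyDeriv (∏ j, X (k₅ j) : MvPolynomial (Fin 3) ℝ) ψ y
  set F := polyDeriv (∏ j, X (k₆ j) : MvPolynomial (Fin 3) ℝ) ψ y
  have e1 := norm_sub_le A B
  have e2 := norm_add_le (A - B) C'
  have e3 := norm_sub_le (A - B + C') D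
  have e4 := norm_add_le (A - B + C' - D) E'
  have e5 := norm_sub_le (A - B + C' - D + E') F
  linarith

/-- `u₁ = X₀ − X₁`. [cite: Humphreys1990, §3.6] -/
theorem norm_polyDeriv_s3HarmonicPoly_one_le (hU : IsOpen U) (hψ : ContDiffOn ℝ ∞ ψ U) (hy : y ∈ U) :
    ‖polyDeriv (s3HarmonicPoly 1) ψ y‖ ≤ 6 * ∑ i ∈ Finset.range 4, ‖iteratedFDeriv ℝ i ψ y‖ := by
  have hS0 : 0 ≤ ∑ i ∈ Finset.range 4, ‖iteratedFDeriv ℝ i ψ y‖ := Finset.sum_nonneg fun _ _ => norm_nonneg _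
  have hS1 := norm_iteratedFDeriv_le_sum_range_four ψ y (show 1 < 4 by norm_num)
  have h : s3HarmonicPoly 1 = (X 0 - X 1 : MvPolynomial (Fin 3) ℝ) := by simp [s3HarmonicPoly]
  rw [h]
  linarith [norm_polyDeriv_X_sub_X_le hU hψ 0 1 hy]

/-- `u₂ = X₁ − X₂`. [cite: Humphreys1990, §3.6] -/
theorem norm_polyDeriv_s3HarmonicPoly_two_le (hU : IsOpen U) (hψ : ContDiffOn ℝ ∞ ψ U) (hy : y ∈ U) :
    ‖polyDeriv (s3HarmonicPoly 2) ψ y‖ ≤ 6 * ∑ i ∈ Finset.range 4, ‖iteratedFDeriv ℝ i ψ y‖ := by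
  have hS0 : 0 ≤ ∑ i ∈ Finset.range 4, ‖iteratedFDeriv ℝ i ψ y‖ := Finset.sum_nonneg fun _ _ => norm_nonneg _
  have hS1 := norm_iteratedFDeriv_le_sum_range_four ψ y (show 1 < 4 by norm_num)
  have h : s3HarmonicPoly 2 = (X 1 - X 2 : MvPolynomial (Fin 3) ℝ) := by simp [s3HarmonicPoly]
  rw [h]
  linarith [norm_polyDeriv_X_sub_X_le hU hψ 1 2 hy]

/-- `u₃ = ∂₀π = 2X₀X₁ − 2X₀X₂ − X₁² + X₂²`. [cite: Humphreys1990, §3.6] -/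
theorem norm_polyDeriv_s3HarmonicPoly_three_le (hU : IsOpen U) (hψ : ContDiffOn ℝ ∞ ψ U) (hy : y ∈ U) :
    ‖polyDeriv (s3HarmonicPoly 3) ψ y‖ ≤ 6 * ∑ i ∈ Finset.range 4, ‖iteratedFDeriv ℝ i ψ y‖ := by
  have hS2 := norm_iteratedFDeriv_le_sum_range_four ψ y (show 2 < 4 by norm_num)
  have h : s3HarmonicPoly 3 = (C (2 : ℝ) * ∏ j, X (![0, 1] j) + C (-2 : ℝ) * ∏ j, X (![0, 2] j) + C (-1 : ℝ) * ∏ j, X (![1, 1] j) + C (1 : ℝ) * ∏ j, X (![2, 2] j) :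
      MvPolynomial (Fin 3) ℝ) := by
    simp only [s3HarmonicPoly, Fin.prod_univ_two, Matrix.cons_val_zero, Matrix.cons_val_one, map_neg, map_one, map_ofNat]
    simp; ring
  rw [h]
  have := norm_polyDeriv_quadratic_le hU hψ hy ![0, 1] ![0, 2] ![1, 1] ![2, 2] 2 (-2) (-1) 1 (by norm_num [abs_of_pos, abs_of_neg])
  linarith

/-- `u₄ = ∂₁π = X₀² − 2X₀X₁ + 2X₁X₂ − X₂²`. [cite: Humphreys1990, §3.6] -/
theorem norm_polyDeriv_s3HarmonicPoly_four_le (hU : IsOpen U) (hψ : ContDiffOn ℝ ∞ ψ U) (hy : y ∈ U) :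
    ‖polyDeriv (s3HarmonicPoly 4) ψ y‖ ≤ 6 * ∑ i ∈ Finset.range 4, ‖iteratedFDeriv ℝ i ψ y‖ := by
  have hS2 := norm_iteratedFDeriv_le_sum_range_four ψ y (show 2 < 4 by norm_num)
  have h : s3HarmonicPoly 4 = (C (1 : ℝ) * ∏ j, X (![0, 0] j) + C (-2 : ℝ) * ∏ j, X (![0, 1] j) + C (2 : ℝ) * ∏ j, X (![1, 2] j) + C (-1 : ℝ) * ∏ j, X (![2, 2] j) :
      MvPolynomial (Fin 3) ℝ) := by
    simp only [s3HarmonicPoly, Fin.prod_univ_two, Matrix.cons_val_zero, Matrix.cons_val_one, map_neg, map_one, map_ofNat]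
    simp; ring
  rw [h]
  have := norm_polyDeriv_quadratic_le hU hψ hy ![0, 0] ![0, 1] ![1, 2] ![2, 2] 1 (-2) 2 (-1) (by norm_num [abs_of_pos, abs_of_neg])
  linarith

/-- `u₅ = π = X₀²X₁ − X₀²X₂ + X₀X₂² − X₀X₁² + X₁²X₂ − X₁X₂²`. [cite: Humphreys1990, §3.6] -/
theorem norm_polyDeriv_s3HarmonicPoly_five_le (hU : IsOpen U) (hψ : ContDiffOn ℝ ∞ ψ U) (hy : y ∈ U) :
    ‖polyDeriv (s3HarmonicPoly 5) ψ y‖ ≤ 6 * ∑ i ∈ Finset.range 4, ‖iteratedFDeriv ℝ i ψ y‖ := by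
  have hS3 := norm_iteratedFDeriv_le_sum_range_four ψ y (show 3 < 4 by norm_num)
  have h : s3HarmonicPoly 5 = (∏ j, X (![0, 0, 1] j) - ∏ j, X (![0, 0, 2] j) + ∏ j, X (![0, 2, 2] j) - ∏ j, X (![0, 1, 1] j) + ∏ j, X (![1, 1, 2] j) -
      ∏ j, X (![1, 2, 2] j) : MvPolynomial (Fin 3) ℝ) := by
    simp only [s3HarmonicPoly, Fin.prod_univ_three, Matrix.cons_val_zero, Matrix.cons_val_one, Matrix.cons_val_two, Matrix.head_cons, Matrix.tail_cons]
    simp; ring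
  rw [h]
  linarith [norm_polyDeriv_cubic_le hU hψ hy ![0, 0, 1] ![0, 0, 2] ![0, 2, 2] ![0, 1, 1] ![1, 1, 2] ![1, 2, 2]]

/-- **`‖∂(u_j)ψ(y)‖ ≤ 6·Σ_{i<4} ‖Dⁱψ(y)‖`** for each of the six `S₃`-harmonics `u = (1, X₀−X₁, X₁−X₂, ∂₀π, ∂₁π, π)` and `ψ` smooth on the open `U ∋ y`. [cite: Humphreys1990, §3.6] [cite: WarnerHASSLG2, §8.4.3] -/
theorem norm_polyDeriv_s3HarmonicPoly_le (hU : IsOpen U) (hψ : ContDiffOn ℝ ∞ ψ U) (hy : y ∈ U) (j : Fin 6) :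
    ‖polyDeriv (s3HarmonicPoly j) ψ y‖ ≤ 6 * ∑ i ∈ Finset.range 4, ‖iteratedFDeriv ℝ i ψ y‖ := by
  fin_cases j
  exacts [norm_polyDeriv_s3HarmonicPoly_zero_le ψ y, norm_polyDeriv_s3HarmonicPoly_one_le hU hψ hy, norm_polyDeriv_s3HarmonicPoly_two_le hU hψ hy,
    norm_polyDeriv_s3HarmonicPoly_three_le hU hψ hy, norm_polyDeriv_s3HarmonicPoly_four_le hU hψ hy, norm_polyDeriv_s3HarmonicPoly_five_le hU hψ hy]

end HarmonicBounds

/-! ## §6 THE REDUCTION: a bound at orders `< 4`, uniform over `h` with `tsupport h ⊆ tsupport f`, is a bound at all orders with the same weight -/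

section Reduction

variable [CompleteSpace E]

/-- **ALL JETS FROM JETS OF ORDERS `≤ 3` WITH THE SAME WEIGHT** (Harish-Chandra's uniform exponent): let `μ` be finite on compacta and right-invariant, `f ∈ C_c^∞(M₃(ℂ); E)`, `S` a subset
of the regular set and `w ≥ 0` a weight on `S`.  If for every `h ∈ C^∞` with `tsupport h ⊆ tsupport f` and every order `i < 4` there is `C` with `‖Dⁱ(liePhi μ h)(θ)‖ ≤ C·w(θ)` on `S`, then for
every order `n` there is `C` with `‖Dⁿ(liePhi μ f)(θ)‖ ≤ C·w(θ)` on `S`.  (§4 + §5 + the sup-norm basis bound ★ FILE 1.) [cite: WarnerHASSLG2, §8.4.3, proof of Thm. 8.4.3.1] -/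
theorem norm_iteratedFDeriv_liePhi_le_of_orders_lt_four (μ : Measure U21) [IsFiniteMeasureOnCompacts μ] [μ.IsMulRightInvariant] {f : Matrix (Fin 3) (Fin 3) ℂ → E}
    (hf : ContDiff ℝ ∞ f) (hfc : HasCompactSupport f) (S : Set (Fin 3 → ℝ)) (hS : S ⊆ {θ : Fin 3 → ℝ | rootProduct θ ≠ 0}) (w : (Fin 3 → ℝ) → ℝ)
    (hcrude : ∀ h : Matrix (Fin 3) (Fin 3) ℂ → E, ContDiff ℝ ∞ h → tsupport h ⊆ tsupport f →
      ∀ i : ℕ, i < 4 → ∃ C : ℝ, 0 ≤ C ∧ ∀ θ ∈ S, ‖iteratedFDeriv ℝ i (liePhi μ h) θ‖ ≤ C * w θ) (n : ℕ) :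
    ∃ C : ℝ, 0 ≤ C ∧ ∀ θ ∈ S, ‖iteratedFDeriv ℝ n (liePhi μ f) θ‖ ≤ C * w θ := by
  classical
  -- the operators `Z k j` of §4, one family per coordinate tuple `k`
  choose Z hZ1 hZ2 hZ3 using fun k : Fin n → Fin 3 => exists_lieOps_iteratedFDeriv_liePhi_apply_single (E := E) μ k
  -- the crude constants for the functions `Z k j f`
  choose! C hC0 hC using hcrude
  have hU := isOpen_setOf_rootProduct_ne_zero
  refine ⟨∑ k : Fin n → Fin 3, ∑ j : Fin 6, 6 * ∑ i ∈ Finset.range 4, C (Z k j f) i, ?_, fun θ hθ => ?_⟩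
  · exact Finset.sum_nonneg fun k _ => Finset.sum_nonneg fun j _ => mul_nonneg (by norm_num)
      (Finset.sum_nonneg fun i hi => hC0 _ (hZ1 k j f hf) (hZ2 k j f) i (Finset.mem_range.1 hi))
  have hθ' : rootProduct θ ≠ 0 := hS hθ
  refine (Literature.Analysis.Calculus.norm_iteratedFDeriv_le_sum_apply_single (liePhi μ f) θ).trans ?_
  rw [Finset.sum_mul]
  refine Finset.sum_le_sum fun k _ => ?_
  rw [hZ3 k f hf hfc θ hθ', Finset.sum_mul]
  refine (norm_sum_le _ _).trans (Finset.sum_le_sum fun j _ => ?_)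
  have hψ : ContDiffOn ℝ ∞ (liePhi μ (Z k j f)) {θ : Fin 3 → ℝ | rootProduct θ ≠ 0} :=
    contDiffOn_liePhi μ (hZ1 k j f hf) (HasCompactSupport.of_support_subset_isCompact hfc ((subset_tsupport _).trans (hZ2 k j f)))
  refine (norm_polyDeriv_s3HarmonicPoly_le hU hψ hθ' j).trans ?_
  rw [mul_assoc, Finset.sum_mul]
  refine mul_le_mul_of_nonneg_left (Finset.sum_le_sum fun i hi => ?_) (by norm_num)
  exact hC _ (hZ1 k j f hf) (hZ2 k j f) i (Finset.mem_range.1 hi) θ hθ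

end Reduction

end BallModel

end Literature.Geometry.ComplexHyperbolic

end
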